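/-
Copyright (c) 2026 the pub-hodgecm-mathlib formalisation cell (harness21).  Prover seat hodgecm-mathlib-A-p12 (g35): P6b wave A seat 1 «FFGS-QUOT» (A), §D
«THE LOCAL ρ-BASIS (GENERAL POSITION OVER AN INFINITE RESIDUE FIELD)» (dealer desk F0P6b-plan (g13) DEAL P6b-A1, director g34 s1734; box F0P6-ref1 (g8)),
2026-09-03.
-/
import Literature.AlgebraicGeometry.GroupSchemes.FiniteFlatGroupSchemeQuotientAffineBasisCriterion
import Mathlib.LinearAlgebra.Determinant
import Mathlib.LinearAlgebra.FiniteDimensional.Lemmas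
import Mathlib.RingTheory.Artinian.Module
import Mathlib.RingTheory.LocalRing.ResidueField.Basic
import Mathlib.RingTheory.Spectrum.Maximal.Basic
import Mathlib.RingTheory.Ideal.GoingUp
import Mathlib.RingTheory.Ideal.Over
import Mathlib.RingTheory.Finiteness.Quotient
import Literature.RingTheory.OrderOfVanishing.NormOrd
import HarnessLib

/-!
# Quotient of an affine scheme by a finite locally free group scheme, §D: the local ρ-basis (Stacks 03BM, general position)

Topic `AlgebraicGeometry/GroupSchemes`; namespace `Literature.AlgebraicGeometry.GroupSchemes.FiniteFlatQuotientAffine` (sub-namespace = the object: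
the affine quotient `X ⧸ Z = Spec C₀` of [MumfordAV1970] §12 Thm. 1 ∕ [SGA3I] Exp. V Thm. 4.1 ∕ [StacksProject] Tag 03BM); THEOREMS ONLY (one `private`
plumbing lemma; no definition, instance, notation or named fact); Mathlib-footed, over §A–§C (`…QuotientAffineTwist`, `…Integral`, `…BasisCriterion`).
Cell `pub/hodgecm-mathlib` (D-0151), organ «FFGS-QUOT» (A) (desk F0P6b-plan (g13) sheet §0; signature sheet `WAVEA-SIGNATURES.v2`
`sig_FFGSQ_A_torsorOverInvariants`), lane `--supports stmt-HodgeConjecture-24832`; count-neutral (banked Row-4B capital).  HC_CM is proved only modulo the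
printed citations (2 remaining named inputs hLiu418 = `stmt-HodgeConjecture-24832`, h413 = `stmt-HodgeConjecture-24833`) until rung 0 closes.

THE SETTING (the signature sheet's, VERBATIM).  `ρ : C →ₐ[R] C ⊗[R] H` a coaction of the commutative Hopf algebra `H` on the commutative `R`-algebra `C`,
invariants `C₀ := AlgHom.equalizer ρ includeLeft`, Galois map `θ := productMap includeLeft ρ : C ⊗[R] C → C ⊗[R] H`, FREE action `hfree : Surjective θ`.

THE LOCAL STEP of [StacksProject] Tag 03BM (= [MumfordAV1970] §12 Thm. 1, proof p. 114, «by Nakayama we may choose `x₁, …, x_n`…» over `k = k̄`):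
* `exists_forall_notMem_of_ne_top` — AVOIDANCE: a module over a local ring `A` with INFINITE residue field is not a finite union of proper submodules
  (lift `#s + 1` distinct non-zero residues to units `tᵣ` with unit differences; on the line `m₀ + tᵣ • y` at most one point per proper submodule; Mathlib
  `Set.Infinite.exists_subset_card_eq`, pigeonhole `Finset.exists_ne_map_eq_of_card_lt_of_maps_to`, `IsLocalRing.residue_ne_zero_iff_isUnit`).
* semilocality of a module-finite algebra over a local ring is the tree's ★ `Literature.RingTheory.OrderOfVanishing.finite_maximalSpectrum` (imported, not
  restated).
* `span_quotient_range_map_coaction_eq_top` — FREENESS read at a residue field `L = C ⧸ 𝔑`: the `L`-span of the reductions `(π ⊗ id)(ρ c)` is all of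
  `L ⊗[R] H` (from `hfree`: `(π ⊗ id)((a ⊗ 1)·ρ c) = π a • (π ⊗ id)(ρ c)`).
* `exists_fin_linearIndependent_quotient` — GENERAL POSITION: for `k ≤ n = rk H` there are `x₁, …, x_k ∈ C` whose reductions `(π_𝔑 ⊗ id)(ρ xᵢ)` are
  `L_𝔑`-linearly independent at EVERY maximal ideal `𝔑` of `C` simultaneously (induction on `k`: the bad loci are proper `C₀`-submodules — proper by the
  spanning and `finrank_range_le_card` — avoided by the avoidance lemma; Mathlib `linearIndependent_finSnoc`).
* `exists_basis_coaction_of_isLocalRing` — **THE LOCAL ρ-BASIS**: `H` finite free with basis `b : ι`, `C₀` local with infinite residue field, `C` semilocal,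
  `θ` surjective ⇒ `∃ x : ι → C` with `ρ (x i)` a `C`-basis of `C ⊗[R] H`: the coordinate determinant `d = det_{1 ⊗ b}(ρ ∘ x)` reduces at each maximal `𝔑`
  to the determinant of an `L_𝔑`-basis (`n` independent vectors in the `n`-dimensional `L_𝔑 ⊗ H`; §A `basis_repr_map_apply`, Mathlib `RingHom.map_det`,
  `Module.Basis.is_basis_iff_det`), so `d` lies in no maximal ideal and is a unit.  NO coassociativity ∕ counit is used for the basis.
* `free_faithfullyFlat_ker_of_isLocalRing` — (A) IN THE LOCAL CASE: with `hcoassoc`∕`hcounit`, `C` is free, finite and faithfully flat over `C₀` and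
  `ker θ = ⟨c ⊗ 1 − 1 ⊗ c | c ∈ C₀⟩` (§C's criterion on the local ρ-basis) — conjuncts 1–3 of the sheet's (A) for free `H`, under «`C₀` local with infinite
  residue field, `C` semilocal» in place of «`R` Noetherian, `C` of finite type»; §E removes the difference by the flat local base change
  `C₀ → C₀[X]_{𝔪[X]}` and faithfully flat descent ([StacksProject] Tag 03BM, first half of the proof).

## References
* [MumfordAV1970] D. Mumford, *Abelian Varieties* (1970), §12 Thm. 1 (A), proof pp. 112–115 (the basis chosen by Nakayama over `k = k̄`).
* [SGA3I] M. Demazure, A. Grothendieck (eds.), *SGA 3, Tome I*, Exp. V, Thm. 4.1 (iv).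
* [StacksProject] The Stacks Project, Tag 03BM (Prop. 39.23.9 and its proof: reduction to a local ring of invariants with infinite residue field, `A`
  semi-local, Algebra Lemma 78.8 general position, then Lemma 03C8).
-/

set_option autoImplicit false

namespace Literature.AlgebraicGeometry.GroupSchemes.FiniteFlatQuotientAffine

open TensorProduct Algebra.TensorProduct

/-! ## §D  The local ρ-basis -/

section Avoid

variable {A : Type*} [CommRing A] [IsLocalRing A] {M : Type*} [AddCommGroup M] [Module A M]

omit [IsLocalRing A] in
/-- A unit scalar cancels in a submodule membership: `a • y ∈ W`, `a` a unit ⇒ `y ∈ W` (the step «`(t − t') y ∈ p_i`, `t ≠ t'` ⇒ `y ∈ p_i`» of the avoidance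
argument). [cite: StacksProject, Tag 03BM] -/
theorem mem_of_isUnit_smul_mem {a : A} (ha : IsUnit a) {W : Submodule A M} {y : M} (h : a • y ∈ W) : y ∈ W := by
  obtain ⟨u, rfl⟩ := ha
  have : u⁻¹ • ((u : A) • y) ∈ W := W.smul_mem _ h
  rwa [← Units.smul_def, inv_smul_smul] at this

/-- **AVOIDANCE over a local ring with infinite residue field**: finitely many PROPER submodules of a module over such a ring do not cover it (the
version of «a vector space over an infinite field is not a finite union of proper subspaces» used in the general-position step of [StacksProject] Tag 03BM:
for `m₀` covered only by `W_j` and `y ∉ W_j`, the points `m₀ + tᵣ • y`, `tᵣ` lifts of `#s + 1` distinct non-zero residues, avoid `W_j`, and two of them in one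
`W_i` would put `y`, hence `m₀`, in `W_i`). [cite: StacksProject, Tag 03BM] -/
theorem exists_forall_notMem_of_ne_top [Infinite (IsLocalRing.ResidueField A)]
    {κ : Type*} (s : Finset κ) (W : κ → Submodule A M) (hW : ∀ i ∈ s, W i ≠ ⊤) :
    ∃ m : M, ∀ i ∈ s, m ∉ W i := by
  classical
  induction s using Finset.induction_on with
  | empty => exact ⟨0, fun i hi => (Finset.notMem_empty i hi).elim⟩
  | insert j s hj ih =>
      obtain ⟨m₀, hm₀⟩ := ih (fun i hi => hW i (Finset.mem_insert_of_mem hi))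
      by_cases hmj : m₀ ∉ W j
      · exact ⟨m₀, fun i hi => by
          rcases Finset.mem_insert.1 hi with rfl | hi
          · exact hmj
          · exact hm₀ i hi⟩
      push Not at hmj
      have hWj : W j ≠ ⊤ := hW j (Finset.mem_insert_self j s)
      obtain ⟨y, hy⟩ : ∃ y, y ∉ W j := by
        by_contra h
        push Not at h
        exact hWj (eq_top_iff.2 fun y _ => h y)
      -- residues: `s.card + 1` distinct nonzero residues
      have hinf : (({0}ᶜ : Set (IsLocalRing.ResidueField A))).Infinite := (Set.finite_singleton _).infinite_compl
      obtain ⟨T, hTsub, hTcard⟩ := hinf.exists_subset_card_eq (s.card + 1)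
      -- lifts
      choose lift hlift using fun r : IsLocalRing.ResidueField A => IsLocalRing.residue_surjective r
      have hunit : ∀ r ∈ T, IsUnit (lift r) := fun r hr => by
        rw [← IsLocalRing.residue_ne_zero_iff_isUnit, hlift]
        exact hTsub hr
      have hunit' : ∀ r ∈ T, ∀ r' ∈ T, r ≠ r' → IsUnit (lift r - lift r') := fun r _ r' _ hrr' => by
        rw [← IsLocalRing.residue_ne_zero_iff_isUnit, map_sub, hlift, hlift, sub_ne_zero]
        exact hrr'
      set z : IsLocalRing.ResidueField A → M := fun r => m₀ + lift r • y with hz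
      have hzj : ∀ r ∈ T, z r ∉ W j := fun r hr hzr => by
        have : lift r • y ∈ W j := by
          have h2 := (W j).sub_mem hzr hmj
          rwa [hz, add_sub_cancel_left] at h2
        exact hy (mem_of_isUnit_smul_mem (hunit r hr) this)
      -- pigeonhole on `s`
      have hex : ∃ r ∈ T, ∀ i ∈ s, z r ∉ W i := by
        by_contra hcon
        push Not at hcon
        choose g hgs hgW using hcon
        obtain ⟨r, hr, r', hr', hne, hgg⟩ := Finset.exists_ne_map_eq_of_card_lt_of_maps_to
          (s := T) (t := s) (f := fun r => if h : r ∈ T then g r h else j) (by rw [hTcard]; omega)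
          (fun r hr => by
            have hr' : r ∈ T := Finset.mem_coe.1 hr
            show (if h : r ∈ T then g r h else j) ∈ (s : Set κ)
            rw [dif_pos hr']
            exact Finset.mem_coe.2 (hgs r hr'))
        rw [dif_pos hr, dif_pos hr'] at hgg
        have h1 : z r ∈ W (g r hr) := hgW r hr
        have h2 : z r' ∈ W (g r hr) := by rw [hgg]; exact hgW r' hr'
        have h3 : (lift r - lift r') • y ∈ W (g r hr) := by
          have := (W (g r hr)).sub_mem h1 h2
          rwa [hz, add_sub_add_left_eq_sub, ← sub_smul] at this
        have hyW : y ∈ W (g r hr) := mem_of_isUnit_smul_mem (hunit' r hr r' hr' hne) h3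
        apply hm₀ (g r hr) (hgs r hr)
        have : m₀ = z r - lift r • y := by rw [hz]; simp
        rw [this]
        exact (W (g r hr)).sub_mem h1 ((W (g r hr)).smul_mem _ hyW)
      obtain ⟨r, hr, hrs⟩ := hex
      refine ⟨z r, fun i hi => ?_⟩
      rcases Finset.mem_insert.1 hi with rfl | hi
      · exact hzj r hr
      · exact hrs i hi

end Avoid



section Local

variable {R : Type*} [CommRing R] {H : Type*} [CommRing H] [HopfAlgebra R H]
  {C : Type*} [CommRing C] [Algebra R C] (ρ : C →ₐ[R] C ⊗[R] H)

/-- In `A ⊗[R] H` with its left `A`-module structure, multiplication by `ℓ ⊗ 1` is the scalar action of `ℓ`. [folklore] -/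
private theorem tmul_one_mul_eq_smul {A : Type*} [CommRing A] [Algebra R A] (ℓ : A) (z : A ⊗[R] H) :
    (ℓ ⊗ₜ[R] (1 : H)) * z = ℓ • z := by
  induction z using TensorProduct.induction_on with
  | zero => simp
  | tmul a h => rw [Algebra.TensorProduct.tmul_mul_tmul, one_mul, TensorProduct.smul_tmul', smul_eq_mul]
  | add u v hu hv => rw [mul_add, smul_add, hu, hv]

/-- **Freeness read at a residue field**: for any ideal `𝔑` of `C`, `L := C ⧸ 𝔑`, the `L`-span of the reductions `(π ⊗ id)(ρ c)`, `c ∈ C`, is all of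
`L ⊗[R] H` — since `θ` is onto and `(π ⊗ id)(θ (a ⊗ c)) = π a • (π ⊗ id)(ρ c)` («`t ⊗ s : A ⊗_C A → B` surjective» read modulo `𝔑`, [StacksProject] Tag 03BM).
[cite: StacksProject, Tag 03BM] -/
theorem span_quotient_range_map_coaction_eq_top
    (hfree : Function.Surjective
      (Algebra.TensorProduct.productMap (Algebra.TensorProduct.includeLeft : C →ₐ[R] C ⊗[R] H) ρ))
    (𝔑 : Ideal C) :
    Submodule.span (C ⧸ 𝔑) (Set.range fun c : C =>
      Algebra.TensorProduct.map (Ideal.Quotient.mkₐ R 𝔑) (AlgHom.id R H) (ρ c)) = ⊤ := by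
  set π := Ideal.Quotient.mkₐ R 𝔑 with hπ
  set S := Submodule.span (C ⧸ 𝔑) (Set.range fun c : C =>
      Algebra.TensorProduct.map (Ideal.Quotient.mkₐ R 𝔑) (AlgHom.id R H) (ρ c)) with hS
  have hθ : ∀ v : C ⊗[R] C, Algebra.TensorProduct.map π (AlgHom.id R H)
      (Algebra.TensorProduct.productMap (Algebra.TensorProduct.includeLeft : C →ₐ[R] C ⊗[R] H) ρ v) ∈ S := by
    intro v
    induction v using TensorProduct.induction_on with
    | zero => simp
    | tmul a c =>
        have : Algebra.TensorProduct.map π (AlgHom.id R H)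
            (Algebra.TensorProduct.productMap (Algebra.TensorProduct.includeLeft : C →ₐ[R] C ⊗[R] H) ρ
              (a ⊗ₜ[R] c)) = (π a) • Algebra.TensorProduct.map π (AlgHom.id R H) (ρ c) := by
          rw [productMap_apply_tmul, map_mul, Algebra.TensorProduct.includeLeft_apply, Algebra.TensorProduct.map_tmul,
            map_one, Algebra.smul_def, Algebra.TensorProduct.algebraMap_apply, Algebra.algebraMap_self,
            RingHom.id_apply]
        rw [this]
        exact S.smul_mem _ (Submodule.subset_span ⟨c, rfl⟩)
    | add u v hu hv => rw [map_add, map_add]; exact S.add_mem hu hv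
  rw [eq_top_iff]
  rintro z -
  induction z using TensorProduct.induction_on with
  | zero => exact S.zero_mem
  | tmul ℓ h =>
      obtain ⟨a, rfl⟩ := Ideal.Quotient.mk_surjective ℓ
      obtain ⟨v, hv⟩ := hfree (a ⊗ₜ[R] h)
      have : (Ideal.Quotient.mk 𝔑 a) ⊗ₜ[R] h = Algebra.TensorProduct.map π (AlgHom.id R H) (a ⊗ₜ[R] h) := by
        rw [Algebra.TensorProduct.map_tmul, AlgHom.id_apply, hπ, Ideal.Quotient.mkₐ_eq_mk]
      rw [this, ← hv]
      exact hθ v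
  | add u v hu hv => exact S.add_mem hu hv

/-- **General position** ([StacksProject] Tag 03BM via Algebra Lemma 78.8): if the invariants `C₀` form a local ring with infinite residue field, `C` is
semilocal, `H` has a finite basis indexed by `ι` and the action is free, then for every `k ≤ #ι` there are `x₁, …, x_k ∈ C` whose reductions
`(π_𝔑 ⊗ id)(ρ xᵢ)` are linearly independent over `L_𝔑 = C ⧸ 𝔑` for EVERY maximal ideal `𝔑` of `C` at once (induction: the set of bad next choices at `𝔑` is a
proper `C₀`-submodule of `C` — proper because the reductions span the `#ι`-dimensional `L_𝔑 ⊗ H` — and finitely many proper submodules do not cover `C`).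
[cite: StacksProject, Tag 03BM] -/
theorem exists_fin_linearIndependent_quotient
    [IsLocalRing (AlgHom.equalizer ρ (Algebra.TensorProduct.includeLeft : C →ₐ[R] C ⊗[R] H))]
    [Infinite (IsLocalRing.ResidueField
      (AlgHom.equalizer ρ (Algebra.TensorProduct.includeLeft : C →ₐ[R] C ⊗[R] H)))]
    [Finite (MaximalSpectrum C)]
    {ι : Type*} [Fintype ι] (b : Module.Basis ι R H)
    (hfree : Function.Surjective
      (Algebra.TensorProduct.productMap (Algebra.TensorProduct.includeLeft : C →ₐ[R] C ⊗[R] H) ρ))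
    (k : ℕ) (hk : k ≤ Fintype.card ι) :
    ∃ x : Fin k → C, ∀ 𝔑 : MaximalSpectrum C,
      LinearIndependent (C ⧸ 𝔑.asIdeal)
        (fun i => Algebra.TensorProduct.map (Ideal.Quotient.mkₐ R 𝔑.asIdeal) (AlgHom.id R H) (ρ (x i))) := by
  classical
  haveI : Module.Finite R H := Module.Finite.of_basis b
  induction k with
  | zero => exact ⟨Fin.elim0, fun 𝔑 => linearIndependent_empty_type⟩
  | succ k ih =>
    obtain ⟨x, hx⟩ := ih (Nat.le_of_succ_le hk)
    set C₀ := AlgHom.equalizer ρ (Algebra.TensorProduct.includeLeft : C →ₐ[R] C ⊗[R] H) with hC₀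
    -- the reduction maps
    let φ : (𝔑 : MaximalSpectrum C) → C → (C ⧸ 𝔑.asIdeal) ⊗[R] H := fun 𝔑 c =>
      Algebra.TensorProduct.map (Ideal.Quotient.mkₐ R 𝔑.asIdeal) (AlgHom.id R H) (ρ c)
    have hφadd : ∀ 𝔑 (a c : C), φ 𝔑 (a + c) = φ 𝔑 a + φ 𝔑 c := fun 𝔑 a c => by
      simp only [φ, map_add]
    have hφsmul : ∀ 𝔑 (r : C₀) (c : C), φ 𝔑 ((r : C) * c) =
        (Ideal.Quotient.mkₐ R 𝔑.asIdeal (r : C)) • φ 𝔑 c := fun 𝔑 r c => by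
      have hr : ρ (r : C) = (r : C) ⊗ₜ[R] (1 : H) := (AlgHom.mem_equalizer _ _ _).1 r.2
      simp only [φ, map_mul, hr, Algebra.TensorProduct.map_tmul, map_one]
      exact tmul_one_mul_eq_smul _ _
    -- the bad submodules
    let W : MaximalSpectrum C → Submodule C₀ C := fun 𝔑 =>
      { carrier := {c | φ 𝔑 c ∈ Submodule.span (C ⧸ 𝔑.asIdeal) (Set.range fun i => φ 𝔑 (x i))}
        add_mem' := fun {a c} ha hc => by
          simp only [Set.mem_setOf_eq, hφadd] at ha hc ⊢
          exact Submodule.add_mem _ ha hc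
        zero_mem' := by simp only [Set.mem_setOf_eq, φ, map_zero]; exact Submodule.zero_mem _
        smul_mem' := fun r c hc => by
          simp only [Set.mem_setOf_eq] at hc ⊢
          rw [show r • c = (r : C) * c from rfl, hφsmul]
          exact Submodule.smul_mem _ _ hc }
    have hWmem : ∀ 𝔑 c, c ∈ W 𝔑 ↔
        φ 𝔑 c ∈ Submodule.span (C ⧸ 𝔑.asIdeal) (Set.range fun i => φ 𝔑 (x i)) := fun _ _ => Iff.rfl
    have hW : ∀ 𝔑, W 𝔑 ≠ ⊤ := by
      intro 𝔑 htop
      letI : Field (C ⧸ 𝔑.asIdeal) := Ideal.Quotient.field 𝔑.asIdeal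
      set Sk := Submodule.span (C ⧸ 𝔑.asIdeal) (Set.range fun i => φ 𝔑 (x i)) with hSk
      have hle : (⊤ : Submodule (C ⧸ 𝔑.asIdeal) ((C ⧸ 𝔑.asIdeal) ⊗[R] H)) ≤ Sk := by
        rw [← span_quotient_range_map_coaction_eq_top ρ hfree 𝔑.asIdeal, Submodule.span_le]
        rintro _ ⟨c, rfl⟩
        exact (hWmem 𝔑 c).1 (htop ▸ Submodule.mem_top)
      have h1 : Module.finrank (C ⧸ 𝔑.asIdeal) Sk ≤ k := by
        simpa only [Set.finrank, Fintype.card_fin] using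
          finrank_range_le_card (R := C ⧸ 𝔑.asIdeal) (fun i => φ 𝔑 (x i))
      have h2 : Module.finrank (C ⧸ 𝔑.asIdeal) ((C ⧸ 𝔑.asIdeal) ⊗[R] H) = Fintype.card ι :=
        Module.finrank_eq_card_basis (Algebra.TensorProduct.basis (C ⧸ 𝔑.asIdeal) b)
      have h3 : Sk = ⊤ := top_le_iff.1 hle
      rw [h3, finrank_top, h2] at h1
      omega
    haveI : Fintype (MaximalSpectrum C) := Fintype.ofFinite _
    obtain ⟨c, hc⟩ := exists_forall_notMem_of_ne_top (Finset.univ : Finset (MaximalSpectrum C)) W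
      (fun 𝔑 _ => hW 𝔑)
    refine ⟨Fin.snoc x c, fun 𝔑 => ?_⟩
    letI : Field (C ⧸ 𝔑.asIdeal) := Ideal.Quotient.field 𝔑.asIdeal
    have hsn : φ 𝔑 ∘ Fin.snoc x c = Fin.snoc (φ 𝔑 ∘ x) (φ 𝔑 c) := Fin.comp_snoc (φ 𝔑) x c
    show LinearIndependent (C ⧸ 𝔑.asIdeal) (φ 𝔑 ∘ Fin.snoc x c)
    rw [hsn, linearIndependent_finSnoc]
    exact ⟨hx 𝔑, (hWmem 𝔑 c).not.1 (hc 𝔑 (Finset.mem_univ _))⟩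

/-- **THE LOCAL ρ-BASIS** ([StacksProject] Tag 03BM: «there exist `x₁, …, x_r ∈ A` such that `M = B` is free over `A` on the basis `s(x₁), …, s(x_r)`»;
[MumfordAV1970] §12 Thm. 1 proof p. 114): `H` finite free (basis `b : ι`), invariants `C₀` local with infinite residue field, `C` semilocal, free action ⇒
there are `x : ι → C` such that the `ρ (x i)` form a `C`-basis of `C ⊗[R] H`.  Proof: take `x` in general position (`exists_fin_linearIndependent_quotient`);
the determinant of the `ρ (x i)` in the basis `1 ⊗ bⱼ` reduces modulo each maximal `𝔑` (§A `basis_repr_map_apply`, `RingHom.map_det`) to the determinant of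
an `L_𝔑`-basis, a unit, so it lies in no maximal ideal and is a unit (`Module.Basis.is_basis_iff_det`).  No coassociativity is used. [cite: StacksProject, Tag 03BM] -/
theorem exists_basis_coaction_of_isLocalRing
    [IsLocalRing (AlgHom.equalizer ρ (Algebra.TensorProduct.includeLeft : C →ₐ[R] C ⊗[R] H))]
    [Infinite (IsLocalRing.ResidueField
      (AlgHom.equalizer ρ (Algebra.TensorProduct.includeLeft : C →ₐ[R] C ⊗[R] H)))]
    [Finite (MaximalSpectrum C)]
    {ι : Type*} [Fintype ι] (b : Module.Basis ι R H)
    (hfree : Function.Surjective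
      (Algebra.TensorProduct.productMap (Algebra.TensorProduct.includeLeft : C →ₐ[R] C ⊗[R] H) ρ)) :
    ∃ (x : ι → C) (β : Module.Basis ι C (C ⊗[R] H)), ∀ i, β i = ρ (x i) := by
  classical
  haveI : Module.Finite R H := Module.Finite.of_basis b
  obtain ⟨x', hx'⟩ := exists_fin_linearIndependent_quotient ρ b hfree (Fintype.card ι) le_rfl
  let e := Fintype.equivFin ι
  let x : ι → C := fun i => x' (e i)
  set bC := Algebra.TensorProduct.basis C b with hbC
  have key : IsUnit (bC.det (fun i => ρ (x i))) := by
    by_contra hnu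
    obtain ⟨𝔑, h𝔑max, hle⟩ := Ideal.exists_le_maximal _ (Ideal.span_singleton_ne_top hnu)
    have hmem : bC.det (fun i => ρ (x i)) ∈ 𝔑 := hle (Ideal.mem_span_singleton_self _)
    letI : Field (C ⧸ 𝔑) := Ideal.Quotient.field 𝔑
    set π := Ideal.Quotient.mkₐ R 𝔑 with hπ
    set bL := Algebra.TensorProduct.basis (C ⧸ 𝔑) b with hbL
    have hdet : π (bC.det (fun i => ρ (x i))) =
        bL.det (fun i => Algebra.TensorProduct.map π (AlgHom.id R H) (ρ (x i))) := by
      rw [Module.Basis.det_apply, Module.Basis.det_apply, ← AlgHom.coe_toRingHom, RingHom.map_det]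
      congr 1
      ext i j
      rw [RingHom.mapMatrix_apply, Matrix.map_apply, Module.Basis.toMatrix_apply, Module.Basis.toMatrix_apply,
        AlgHom.coe_toRingHom]
      exact (basis_repr_map_apply b π (ρ (x j)) i).symm
    have hli : LinearIndependent (C ⧸ 𝔑)
        (fun i : ι => Algebra.TensorProduct.map π (AlgHom.id R H) (ρ (x i))) :=
      (hx' ⟨𝔑, h𝔑max⟩).comp e e.injective
    have hspan := hli.span_eq_top_of_card_eq_finrank' (by rw [Module.finrank_eq_card_basis bL])
    have hunit : IsUnit (bL.det (fun i => Algebra.TensorProduct.map π (AlgHom.id R H) (ρ (x i)))) :=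
      bL.is_basis_iff_det.1 ⟨hli, hspan⟩
    rw [← hdet] at hunit
    exact hunit.ne_zero (by rw [hπ, Ideal.Quotient.mkₐ_eq_mk]; exact Ideal.Quotient.eq_zero_iff_mem.2 hmem)
  obtain ⟨hli, hsp⟩ := bC.is_basis_iff_det.2 key
  exact ⟨x, Module.Basis.mk hli hsp.ge, fun i => Module.Basis.mk_apply _ _ _⟩


/-- **«FFGS-QUOT» (A) over a LOCAL ring of invariants with INFINITE residue field** ([StacksProject] Tag 03BM, the heart of the proof: «Assume `C` is a
local ring with infinite residue field … there exist `x₁, …, x_r ∈ A` such that `B` is free over `A` on the basis `s(x₁), …, s(x_r)`; hence `C → A` is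
finite free and `B ≅ A ⊗_C A` by Lemma 03C8»): for `H` finite free, a coassociative counital FREE coaction whose invariants `C₀` form a local ring with
infinite residue field and with `C` semilocal (e.g. finite over `C₀`: ★ `Literature.RingTheory.OrderOfVanishing.finite_maximalSpectrum`), `C` is FREE and FAITHFULLY
FLAT over `C₀` and the Galois map has kernel `⟨c ⊗ 1 − 1 ⊗ c | c ∈ C₀⟩` (the local ρ-basis of `exists_basis_coaction_of_isLocalRing` fed into §C).
[cite: StacksProject, Tag 03BM] -/
theorem free_faithfullyFlat_ker_of_isLocalRing [Module.Free R H] [Module.Finite R H]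
    [IsLocalRing (AlgHom.equalizer ρ (Algebra.TensorProduct.includeLeft : C →ₐ[R] C ⊗[R] H))]
    [Infinite (IsLocalRing.ResidueField
      (AlgHom.equalizer ρ (Algebra.TensorProduct.includeLeft : C →ₐ[R] C ⊗[R] H)))]
    [Finite (MaximalSpectrum C)]
    (hcoassoc : ∀ c : C, TensorProduct.map LinearMap.id (Coalgebra.comul (R := R) (A := H)) (ρ c) =
      TensorProduct.assoc R C H H (TensorProduct.map ρ.toLinearMap LinearMap.id (ρ c)))
    (hcounit : ∀ c : C, TensorProduct.rid R C
      (TensorProduct.map LinearMap.id (Coalgebra.counit (R := R) (A := H)) (ρ c)) = c)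
    (hfree : Function.Surjective
      (Algebra.TensorProduct.productMap (Algebra.TensorProduct.includeLeft : C →ₐ[R] C ⊗[R] H) ρ)) :
    Module.Free (AlgHom.equalizer ρ (Algebra.TensorProduct.includeLeft : C →ₐ[R] C ⊗[R] H)) C ∧
    Module.Finite (AlgHom.equalizer ρ (Algebra.TensorProduct.includeLeft : C →ₐ[R] C ⊗[R] H)) C ∧
    Module.FaithfullyFlat (AlgHom.equalizer ρ (Algebra.TensorProduct.includeLeft : C →ₐ[R] C ⊗[R] H)) C ∧
    RingHom.ker (Algebra.TensorProduct.productMap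
        (Algebra.TensorProduct.includeLeft : C →ₐ[R] C ⊗[R] H) ρ).toRingHom =
      Ideal.span {w : C ⊗[R] C | ∃ c ∈ AlgHom.equalizer ρ
        (Algebra.TensorProduct.includeLeft : C →ₐ[R] C ⊗[R] H), w = c ⊗ₜ[R] (1 : C) - (1 : C) ⊗ₜ[R] c} := by
  obtain ⟨x, β, hβ⟩ := exists_basis_coaction_of_isLocalRing ρ (Module.Free.chooseBasis R H) hfree
  exact ⟨free_invariants_of_basis ρ x β hβ hcoassoc hcounit,
    finite_invariants_of_basis ρ x β hβ hcoassoc hcounit,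
    faithfullyFlat_invariants_of_basis ρ x β hβ hcoassoc hcounit,
    ker_productMap_eq_span_of_basis ρ x β hβ hcoassoc hcounit⟩

end Local

end Literature.AlgebraicGeometry.GroupSchemes.FiniteFlatQuotientAffine
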